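import Summits.CriticalPhenomena.Ising3DConformalLimit.Theses.HyperoctahedralRP
import Summits.CriticalPhenomena.Ising3DConformalLimit.Theorems.HyperoctahedralRPTwoPointKernelOfLimit
import Summits.CriticalPhenomena.Ising3DConformalLimit.Theorems.GaussianScaleMixtureRotationUpgradeFromTwoPoint
import HarnessLib

/-!
# Crux `HyperoctahedralRP.LimitRotationInvariant` (stmt-CriticalPhenomena-1980) — PROVED, as a corollary of
# crux `GaussianScaleMixture.RotationUpgradeFromTwoPoint` (stmt-CriticalPhenomena-8367)

`LimitRotationInvariant` = `HRP2Rigidity → ∀ (ρ, Δ, S), (H1)–(H6) → IsRotationInvariant S`.  Given `HRP2Rigidity` (crux (A)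
of the route, its HYPOTHESIS here) and (H1)–(H6), the landed support item `TwoPointKernelOfLimit`
(`HyperoctahedralRPTwoPoint.twoPointKernelOfLimit_proof`: window, continuity, positivity, homogeneity and nine-mirror
reflection positivity of the two-point kernel `v ↦ S 2 ![0, v]`) feeds `HRP2Rigidity`, which returns two-point isotropy
`S 2 ![0, R v] = S 2 ![0, v]` — hypothesis (H7) of crux stmt-8367; and that crux is the landed theorem
`NullLaplacianEdgeGaussianity.rotationUpgradeFromTwoPoint_proof` (line `null-laplacian-edge-gaussianity`: Gaussian locus by
Wick; edge `Δ = 1/2` Gaussian by the OS null vector + Bôcher–Liouville; interior by the multiple-reflection unit sigma bound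
+ the `quarter-turn-liouville` machinery of THIS crux's own line).  So both isotropy cruxes of the sub-problem are closed by
the same sigma bound, exactly as recorded by the leads of both lines.
-/

noncomputable section

open Literature.Probability.LatticeModels

namespace Summit.CriticalPhenomena.Ising3DConformalLimit.Cruxes.LimitRotationInvariant.QuarterTurnLiouville

/-- **Crux `LimitRotationInvariant` (item stmt-CriticalPhenomena-1980) — PROVED.**  Assuming `HRP2Rigidity`, every
normalised, non-degenerate, translation-invariant, scale-covariant pointwise scaling limit of the critical `ℤ³` Ising
correlators is `O(3)`-invariant at all orders: `HRP2Rigidity ∘ TwoPointKernelOfLimit` gives two-point isotropy, and crux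
stmt-8367 (`rotationUpgradeFromTwoPoint_proof`) upgrades it to all orders. -/
theorem limitRotationInvariant_proof :
    Summit.CriticalPhenomena.Ising3DConformalLimit.Theses.HyperoctahedralRP.LimitRotationInvariant := by
  intro hA ρ Δ S hρ hlim hnorm hnd htr hsc
  obtain ⟨hΔ, hK, hpos, hhom, hmir⟩ :=
    HyperoctahedralRPTwoPoint.twoPointKernelOfLimit_proof ρ Δ S hρ hlim hnd htr hsc
  have hiso : ∀ (R : EuclideanSpace ℝ (Fin 3) ≃ₗᵢ[ℝ] EuclideanSpace ℝ (Fin 3)) (v : EuclideanSpace ℝ (Fin 3)),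
      S 2 ![0, R v] = S 2 ![0, v] :=
    hA Δ (fun v => S 2 ![0, v]) hΔ.1 hΔ.2 hK hpos hhom hmir
  exact RotationUpgradeFromTwoPoint.NullLaplacianEdgeGaussianity.rotationUpgradeFromTwoPoint_proof ρ Δ S hρ hlim hnorm
    hnd htr hsc (fun R x _ => hiso R x)

/-- The skeleton's name for the same theorem (the registered composition `LimitRotationInvariant_of` of
`Lines/quarter_turn_liouville.lean`; its one open stub `stub_unitSigmaBound` is bypassed through crux stmt-8367). -/
theorem LimitRotationInvariant_of :
    Summit.CriticalPhenomena.Ising3DConformalLimit.Theses.HyperoctahedralRP.LimitRotationInvariant :=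
  limitRotationInvariant_proof

end Summit.CriticalPhenomena.Ising3DConformalLimit.Cruxes.LimitRotationInvariant.QuarterTurnLiouville

end
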